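import Summits.AtomisticToContinuum.Crystallization.Theses.BrittleRungDescent

/-!
# Line `birth` — birth-certificate skeleton (BC3) for the crux `LocalHalesKernel`
(stmt-AtomisticToContinuum-9208, route `BrittleRungDescent`, rank 6; sub-problem `Crystallization`)

THE CRUX (effective local Hales at radius 2, tolerance `η = 1/400`, gap `h₀ = 63/50`): if `u ∈ S ⊂ ℝ³`
and every point of `S` within `401/400` of `u` is softly twelve-kissed (all other points of `S` at
distance `≥ 399/400`, exactly twelve within `401/400`, none in `(401/400, 63/50)`), then the soft
contact graph (pairs within `401/400`) on the twelve soft neighbours of `u` is isomorphic to the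
contact graph (pairs at distance `1`) of `fccKissingPattern` or of `hcpKissingPattern`.

WHAT THE HYPOTHESIS REALLY GIVES (refuter audit g41-12, evidence `LocalHalesKernel_eta400_audit.md`):
the twelve-kissedness of the NEIGHBOURS constrains only the thirteen atoms `u, p₀, …, p₁₁` — it is a
12-point soft spherical code with the Hales gap: radii `dist u pᵢ ∈ [399/400, 401/400]`, pairwise
`dist pᵢ pⱼ ∈ [399/400, 401/400] ∪ [63/50, ∞)`.  The PROVED extraction below (`composition`, used by
`LocalHalesKernel_of`) reduces the Set/`ncard`-typed crux to exactly this finite datum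
`(u, p : Fin 12 → ℝ³)`, once, for all three stubs; the stubs are stated over it (one line each, fully qualified, no `let`, no local defs, so a
`Theorems/`-side prover restates them verbatim).

THE LINE — "soft Lemma 7 → 4-regularity → quartic classification" (the degree/face-census
architecture of Hales, arXiv:1209.6043, Lemma 7 / Thm 3 / Lemmas 8–9, made EFFECTIVE at `η = 1/400`;
the exact `η = 0` Lemma 7 and Lemmas 9–10 are PROVED in tree: `KissingNodeDegree.lean`,
`TameContactGraphs.lean`, `KissingRigidity.lean`):

* `stub_softDegreeLeFour` (M; provable now) — SOFT LEMMA 7: in a `1/400`-soft gapped twelve-shell every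
  shell point has AT MOST FOUR soft contacts among the other eleven.  Azimuths about the axis `u pᵢ`:
  two neighbours of `pᵢ` at mutual distance `≥ 399/400` are `≥ 69.99°` apart, a soft contact pair is
  `≤ 71.08°` apart, a gap pair (`≥ 63/50`) is `≥ 92.84°` apart (worst cases over radii and bonds in
  `[399/400, 401/400]`, folder `azimuth_check.py`; refuter g41-12's rigorous relaxation: `71.21°`).
  Five neighbours: five cyclic gaps summing to `360°`, each `≤ 360 − 4·69.99 = 80.04° < 92.84°`, so all
  five are contacts and the sum is `≤ 5·71.08 = 355.4° < 360°` — impossible; six: `6·69.99 > 360`.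
  Template: the PROVED exact version `Literature.Geometry.DiscreteGeometry.no_five_neighbours` /
  `IsKissingConfig.degree_le_four` (tangent coordinates, `five_sorted_angles_false`), with the two
  equalities `‖·‖ = 2`, `dist = 2` replaced by two-sided bounds.  This stub alone kills every witness
  on record: the decahedral `D₅ₕ` shell that refuted the `1/100` twin (two 5-valent poles; closes only
  for `η ≥ η⋆ ≈ 0.0067`, `BrittleMieDescentEffectiveLocalHales_refuted`) and the torn icosahedra that
  refuted `GappedShellCensus.ShellCensus` at `1/50` (seven 5-valent vertices, alive down to `≈ 1.77 %`,
  `GappedShellCensusShellCensus_refuted`).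
* `stub_softDegreeGeFour` (L/XL; THE HARDEST, the crux's declared residual risk) — 4-REGULARITY FROM
  BELOW: every shell point has AT LEAST FOUR soft contacts.  With stub 1 this is `E = 24`.  Known budget
  (audit g41-12): cap-area Bonferroni gives `E ≥ 22`; the face-area census kills `E = 22`; the only
  non-pattern census left is `E = 23` = (6 triangles, 7 quadrilaterals, two 3-valent nodes) — Hales's
  tame graph `141162467639` (`tameContactGraph 2`, killed at `η = 0` by `y{0,2} = 2α₃ > β₄`,
  `IsKissingConfig.isEmpty_iso_tameContactGraph_two`); numerically every single-contact deletion of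
  fcc/hcp needs `η ≈ 0.0175–0.021` to close (refuter g42-13, `lh_local.py`), `7–8×` above `1/400`.
  Proof routes: soft area census + a soft version of the graph-2 certificate, or one certified
  branch-and-bound over 12-point codes (the `ShellCensusReplay` checker family, `Spec` at `1/400`).
* `stub_softQuarticIsFccOrHcp` (L) — CLASSIFICATION OF 4-REGULAR SOFT SHELLS: if every shell point has
  exactly four soft contacts, the soft contact graph is the cuboctahedron (fcc) or anticuboctahedron
  (hcp) graph, as a `Fin 12 ≃ pattern` matching soft contacts with unit pattern distances.  Content:
  the contact fan is planar (`isFan_codeContactGraph`-type, soft), `V − E + F = 2` gives `F = 14`;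
  vertex types at `η = 1/400` are `(2,2,0)` or carry a `≥ 5`-gon; the `(2,2,0)`-everywhere family has
  `t = 8, q = 6` (13 quartic 3-connected planar graphs on 12 nodes in all) and the soft LP/angle
  certificates single out the two patterns (exact templates: `isEmpty_iso_tameContactGraph_three …
  _seven`, `nonempty_tameContactGraph_zero_iso_hcp`, `nonempty_tameContactGraph_one_iso_fcc`); soft
  rigidity (Lemma 10) is NOT needed — the crux asks for the graph, not congruence.
* `composition` (PROVED, sorry-free, axioms standard) — the glue
  `stub₁-sig → stub₂-sig → stub₃-sig → LocalHalesKernel`, and `LocalHalesKernel_of : LocalHalesKernel` —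
  the crux concluded BY NAME with the three declared stubs discharged inside (`sorry` only in `stub_*`).
  The glue: index the soft neighbour type `{w // w ∈ S ∧ w ≠ u ∧ dist u w ≤ 401/400}` by `Fin 12` from `ncard = 12`
  (`Nat.finite_of_card_ne_zero`, `Finite.equivFin`), read the radial bounds off the kissedness of `u` and
  the pairwise dichotomy off the kissedness of each neighbour `pᵢ ∈ S` (this is where the radius-2
  hypothesis is consumed), get `degree = 4` from stubs 1–2 by antisymmetry, apply stub 3, and transport
  the pattern bijection back along the indexing equivalence.

Disproof used: none exists for this crux (`ledger crux ls stmt-AtomisticToContinuum-9208`: no workfiles,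
2026-08-17).  Negatives index (20 entries, 2026-08-17): two bear on this crux and both witnesses have
5-valent shell points, i.e. they are instances `stub_softDegreeLeFour` EXCLUDES at `1/400`, not instances
it asserts — `EffectiveLocalHales@1/100` (stmt-4146, decahedral shell, threshold `0.0067 > 1/400`) and
`ShellCensus@1/50` (stmt-15929, torn icosahedron, threshold `≈ 0.0177 > 1/400`).  No stub restates the
crux, the sub-problem `Crystallization`, or a refuted statement; every stub is implied by the crux
(fcc/hcp graphs are 4-regular), so the split adds no risk beyond the crux's own.

Conventions: stub signatures are ONE LINE, FULLY QUALIFIED; degrees are written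
`{j : Fin 12 | j ≠ i ∧ dist (p i) (p j) ≤ 1 + 1 / 400}.ncard` (a set of `Fin 12`, always finite).
-/

noncomputable section

namespace Summit.AtomisticToContinuum.Crystallization.Cruxes.LocalHalesKernel.Birth

open Summit.AtomisticToContinuum.Crystallization.Theses.BrittleRungDescent

local notation "E3" => EuclideanSpace ℝ (Fin 3)

/-! ## Registered stubs (sorries live ONLY here) -/

/-- **STUB 1 — soft Lemma 7: at most four soft contacts per shell point** (size M, provable now).
For twelve points `p i` with `dist u (p i) ∈ [399/400, 401/400]` and pairwise distances in
`[399/400, 401/400] ∪ [63/50, ∞)`, every `p i` has at most four `p j` within `401/400`.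
Azimuthal budget about the axis `u (p i)` at `η = 1/400`: any two neighbours `≥ 69.99°` apart, contact
pairs `≤ 71.08°`, gap pairs `≥ 92.84°`; five cyclic gaps cannot sum to `360°`
(`5·71.08 < 360 < 4·69.99 + 92.84`).  Exact template PROVED in tree:
`Literature.Geometry.DiscreteGeometry.no_five_neighbours`, `IsKissingConfig.degree_le_four`. -/
theorem stub_softDegreeLeFour : ∀ (u : EuclideanSpace ℝ (Fin 3)) (p : Fin 12 → EuclideanSpace ℝ (Fin 3)), (∀ i : Fin 12, 1 - 1 / 400 ≤ dist u (p i) ∧ dist u (p i) ≤ 1 + 1 / 400) → (∀ i j : Fin 12, i ≠ j → 1 - 1 / 400 ≤ dist (p i) (p j) ∧ (dist (p i) (p j) ≤ 1 + 1 / 400 ∨ 63 / 50 ≤ dist (p i) (p j))) → ∀ i : Fin 12, {j : Fin 12 | j ≠ i ∧ dist (p i) (p j) ≤ 1 + 1 / 400}.ncard ≤ 4 := by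
  sorry

/-- **STUB 2 — 4-regularity from below: at least four soft contacts per shell point** (size L/XL;
THE HARDEST stub, the crux's declared residual risk).  Same soft gapped twelve-shell; conclusion: every
`p i` has at least four `p j` within `401/400` (with stub 1: exactly `24` soft contacts).  Budget on
record: cap-area Bonferroni `E ≥ 22`, face-area census kills `E = 22`, leaving the `E = 23` census
(6 triangles, 7 quadrilaterals, two 3-valent nodes = Hales's tame graph `tameContactGraph 2`, killed at
`η = 0` by `IsKissingConfig.isEmpty_iso_tameContactGraph_two`); single-contact deletions of fcc/hcp
close only for `η ≳ 0.0175` (numerical, refuter g42-13).  Why it might fail: an exotic 23-contact soft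
code inside the `0.25 %` window (none known). -/
theorem stub_softDegreeGeFour : ∀ (u : EuclideanSpace ℝ (Fin 3)) (p : Fin 12 → EuclideanSpace ℝ (Fin 3)), (∀ i : Fin 12, 1 - 1 / 400 ≤ dist u (p i) ∧ dist u (p i) ≤ 1 + 1 / 400) → (∀ i j : Fin 12, i ≠ j → 1 - 1 / 400 ≤ dist (p i) (p j) ∧ (dist (p i) (p j) ≤ 1 + 1 / 400 ∨ 63 / 50 ≤ dist (p i) (p j))) → ∀ i : Fin 12, 4 ≤ {j : Fin 12 | j ≠ i ∧ dist (p i) (p j) ≤ 1 + 1 / 400}.ncard := by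
  sorry

/-- **STUB 3 — classification of 4-regular soft shells** (size L).  A `1/400`-soft gapped twelve-shell
in which every point has exactly four soft contacts has the soft contact graph of the cuboctahedron or
of the anticuboctahedron: a bijection `Fin 12 ≃ fccKissingPattern` (resp. `hcpKissingPattern`) matching
soft contacts (`≤ 401/400`) with unit pattern distances.  Planar contact fan, `F = 14`, vertex types
`(2,2,0)` or with a `≥ 5`-gon, soft LP/angle certificates against the other quartic planar graphs
(exact templates PROVED in tree: `IsKissingConfig.isEmpty_iso_tameContactGraph_three … _seven`,
`nonempty_tameContactGraph_zero_iso_hcp`, `nonempty_tameContactGraph_one_iso_fcc`).  No rigidity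
(Lemma 10) needed.  Why it might fail: only through a margin of a soft certificate, none known thin. -/
theorem stub_softQuarticIsFccOrHcp : ∀ (u : EuclideanSpace ℝ (Fin 3)) (p : Fin 12 → EuclideanSpace ℝ (Fin 3)), (∀ i : Fin 12, 1 - 1 / 400 ≤ dist u (p i) ∧ dist u (p i) ≤ 1 + 1 / 400) → (∀ i j : Fin 12, i ≠ j → 1 - 1 / 400 ≤ dist (p i) (p j) ∧ (dist (p i) (p j) ≤ 1 + 1 / 400 ∨ 63 / 50 ≤ dist (p i) (p j))) → (∀ i : Fin 12, {j : Fin 12 | j ≠ i ∧ dist (p i) (p j) ≤ 1 + 1 / 400}.ncard = 4) → (∃ e : Fin 12 ≃ {q : EuclideanSpace ℝ (Fin 3) // q ∈ Literature.Geometry.DiscreteGeometry.fccKissingPattern}, ∀ i j : Fin 12, i ≠ j → (dist (p i) (p j) ≤ 1 + 1 / 400 ↔ dist (e i).1 (e j).1 = 1)) ∨ (∃ e : Fin 12 ≃ {q : EuclideanSpace ℝ (Fin 3) // q ∈ Literature.Geometry.DiscreteGeometry.hcpKissingPattern}, ∀ i j : Fin 12, i ≠ j → (dist (p i) (p j) ≤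 1 + 1 / 400 ↔ dist (e i).1 (e j).1 = 1)) := by
  sorry

/-! ## Proved composition: the three stubs imply the crux, by name -/

/-- **Extraction + composition (PROVED, sorry-free, axioms `propext`/`Classical.choice`/`Quot.sound`).**
`stub₁-sig → stub₂-sig → stub₃-sig → (LocalHalesKernel, unfolded verbatim)`: the twelve soft neighbours of `u` are indexed by
`Fin 12` (`ncard = 12`), the radial window comes from the kissedness of `u`, the pairwise dichotomy from
the kissedness of each neighbour (a point of `S` within `401/400` of `u`), stubs 1–2 give 4-regularity,
stub 3 the pattern bijection, which is transported back along the indexing equivalence. [folklore] -/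
theorem composition :
    (∀ (u : EuclideanSpace ℝ (Fin 3)) (p : Fin 12 → EuclideanSpace ℝ (Fin 3)), (∀ i : Fin 12, 1 - 1 / 400 ≤ dist u (p i) ∧ dist u (p i) ≤ 1 + 1 / 400) → (∀ i j : Fin 12, i ≠ j → 1 - 1 / 400 ≤ dist (p i) (p j) ∧ (dist (p i) (p j) ≤ 1 + 1 / 400 ∨ 63 / 50 ≤ dist (p i) (p j))) → ∀ i : Fin 12, {j : Fin 12 | j ≠ i ∧ dist (p i) (p j) ≤ 1 + 1 / 400}.ncard ≤ 4) →
    (∀ (u : EuclideanSpace ℝ (Fin 3)) (p : Fin 12 → EuclideanSpace ℝ (Fin 3)), (∀ i : Fin 12, 1 - 1 / 400 ≤ dist u (p i) ∧ dist u (p i) ≤ 1 + 1 / 400) → (∀ i j : Fin 12, i ≠ j → 1 - 1 / 400 ≤ dist (p i) (p j) ∧ (dist (p i) (p j) ≤ 1 + 1 / 400 ∨ 63 / 50 ≤ dist (p i) (p j))) → ∀ i : Fin 12, 4 ≤ {j : Fin 12 | j ≠ i ∧ dist (p i) (p j) ≤ 1 + 1 / 400}.ncard) →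
    (∀ (u : EuclideanSpace ℝ (Fin 3)) (p : Fin 12 → EuclideanSpace ℝ (Fin 3)), (∀ i : Fin 12, 1 - 1 / 400 ≤ dist u (p i) ∧ dist u (p i) ≤ 1 + 1 / 400) → (∀ i j : Fin 12, i ≠ j → 1 - 1 / 400 ≤ dist (p i) (p j) ∧ (dist (p i) (p j) ≤ 1 + 1 / 400 ∨ 63 / 50 ≤ dist (p i) (p j))) → (∀ i : Fin 12, {j : Fin 12 | j ≠ i ∧ dist (p i) (p j) ≤ 1 + 1 / 400}.ncard = 4) → (∃ e : Fin 12 ≃ {q : EuclideanSpace ℝ (Fin 3) // q ∈ Literature.Geometry.DiscreteGeometry.fccKissingPattern}, ∀ i j : Fin 12, i ≠ j → (dist (p i) (p j) ≤ 1 + 1 / 400 ↔ dist (e i).1 (e j).1 = 1)) ∨ (∃ e : Fin 12 ≃ {q : EuclideanSpace ℝ (Fin 3) // q ∈ Literature.Geometry.DiscreteGeometry.hcpKissingPattern}, ∀ i j : Fin 12, i ≠ j → (dist (p i) (p j) ≤ 1 + 1 / 400 ↔ dist (e i).1 (e j).1 = 1))) →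
    -- the conclusion is the crux `LocalHalesKernel` UNFOLDED verbatim (so that the registered
    -- theorem concluding the crux BY NAME is `LocalHalesKernel_of` below, `:= composition stub₁ stub₂ stub₃`)
    ∀ (S : Set (EuclideanSpace ℝ (Fin 3))) (u : EuclideanSpace ℝ (Fin 3)), u ∈ S → (∀ v ∈ S, dist u v ≤ 1 + 1 / 400 → ((∀ w ∈ S, w ≠ v → 1 - 1 / 400 ≤ dist v w ∧ (dist v w ≤ 1 + 1 / 400 ∨ 63 / 50 ≤ dist v w)) ∧ {w ∈ S | w ≠ v ∧ dist v w ≤ 1 + 1 / 400}.ncard = 12)) → ((∃ e : {w : EuclideanSpace ℝ (Fin 3) // w ∈ S ∧ w ≠ u ∧ dist u w ≤ 1 + 1 / 400} ≃ {q : EuclideanSpace ℝ (Fin 3) // q ∈ Literature.Geometry.DiscreteGeometry.fccKissingPattern}, ∀ w w' : {w : EuclideanSpace ℝ (Fin 3) // w ∈ S ∧ w ≠ u ∧ dist u w ≤ 1 + 1 / 400}, w ≠ w' → (dist w.1 w'.1 ≤ 1 + 1 / 400 ↔ dist (e w).1 (e w').1 = 1)) ∨ (∃ e : {w : EuclideanSpace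 ℝ (Fin 3) // w ∈ S ∧ w ≠ u ∧ dist u w ≤ 1 + 1 / 400} ≃ {q : EuclideanSpace ℝ (Fin 3) // q ∈ Literature.Geometry.DiscreteGeometry.hcpKissingPattern}, ∀ w w' : {w : EuclideanSpace ℝ (Fin 3) // w ∈ S ∧ w ≠ u ∧ dist u w ≤ 1 + 1 / 400}, w ≠ w' → (dist w.1 w'.1 ≤ 1 + 1 / 400 ↔ dist (e w).1 (e w').1 = 1))) := by
  intro hA hB hC S u hu hH
  -- the kissedness of `u` itself: radial lower bounds and `ncard = 12`
  have hu' := hH u hu (by rw [dist_self]; norm_num)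
  have hcard : {w ∈ S | w ≠ u ∧ dist u w ≤ 1 + 1 / 400}.ncard = 12 := hu'.2
  -- index the soft neighbour type by `Fin 12`
  have hN : Nat.card {w : E3 // w ∈ S ∧ w ≠ u ∧ dist u w ≤ 1 + 1 / 400} = 12 := hcard
  haveI : Finite {w : E3 // w ∈ S ∧ w ≠ u ∧ dist u w ≤ 1 + 1 / 400} :=
    Nat.finite_of_card_ne_zero (by rw [hN]; norm_num)
  obtain ⟨eN⟩ : Nonempty ({w : E3 // w ∈ S ∧ w ≠ u ∧ dist u w ≤ 1 + 1 / 400} ≃ Fin 12) :=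
    ⟨(Finite.equivFin _).trans (finCongr hN)⟩
  set p : Fin 12 → E3 := fun i => (eN.symm i).1 with hp
  have hmem : ∀ i, p i ∈ S ∧ p i ≠ u ∧ dist u (p i) ≤ 1 + 1 / 400 := fun i => (eN.symm i).2
  have hR : ∀ i : Fin 12, 1 - 1 / 400 ≤ dist u (p i) ∧ dist u (p i) ≤ 1 + 1 / 400 := fun i =>
    ⟨(hu'.1 (p i) (hmem i).1 (hmem i).2.1).1, (hmem i).2.2⟩
  have hinj : ∀ i j : Fin 12, i ≠ j → p i ≠ p j := by
    intro i j hij h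
    exact hij (eN.symm.injective (Subtype.ext h))
  have hP : ∀ i j : Fin 12, i ≠ j → 1 - 1 / 400 ≤ dist (p i) (p j) ∧
      (dist (p i) (p j) ≤ 1 + 1 / 400 ∨ 63 / 50 ≤ dist (p i) (p j)) := by
    intro i j hij
    exact (hH (p i) (hmem i).1 (hmem i).2.2).1 (p j) (hmem j).1 (hinj j i (Ne.symm hij))
  -- 4-regularity from stubs 1 and 2
  have h4 : ∀ i : Fin 12, {j : Fin 12 | j ≠ i ∧ dist (p i) (p j) ≤ 1 + 1 / 400}.ncard = 4 :=
    fun i => le_antisymm (hA u p hR hP i) (hB u p hR hP i)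
  -- the value of `p` on an indexed neighbour
  have hpe : ∀ w : {w : E3 // w ∈ S ∧ w ≠ u ∧ dist u w ≤ 1 + 1 / 400}, p (eN w) = w.1 := by
    intro w
    simp only [hp, Equiv.symm_apply_apply]
  -- stub 3 and transport along `eN`
  rcases hC u p hR hP h4 with ⟨σ, hσ⟩ | ⟨σ, hσ⟩
  · refine Or.inl ⟨eN.trans σ, fun w w' hne => ?_⟩
    have hij : eN w ≠ eN w' := fun h => hne (eN.injective h)
    have key := hσ (eN w) (eN w') hij
    rw [hpe w, hpe w'] at key
    simpa only [Equiv.trans_apply] using key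
  · refine Or.inr ⟨eN.trans σ, fun w w' hne => ?_⟩
    have hij : eN w ≠ eN w' := fun h => hne (eN.injective h)
    have key := hσ (eN w) (eN w') hij
    rw [hpe w, hpe w'] at key
    simpa only [Equiv.trans_apply] using key

/-- **The crux concluded BY NAME from the three declared stubs** (the registered form: no hypothesis;
the only `sorry`s it reaches are those inside `stub_softDegreeLeFour`, `stub_softDegreeGeFour`,
`stub_softQuarticIsFccOrHcp`; the glue is `composition`, proved above). [folklore] -/
theorem LocalHalesKernel_of : LocalHalesKernel :=
  composition stub_softDegreeLeFour stub_softDegreeGeFour stub_softQuarticIsFccOrHcp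

end Summit.AtomisticToContinuum.Crystallization.Cruxes.LocalHalesKernel.Birth

end
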